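import Summits.QuantumFields.YangMills.Theorems.UnitScaleTiltProp7FrameCorrectedKernelSlice
import Summits.QuantumFields.YangMills.Theorems.UnitScaleTiltProp7FrameCorrectedMinusMeanL2
import Summits.QuantumFields.YangMills.Theorems.UnitScaleTiltProp7FrameResponseLinear
import Summits.QuantumFields.YangMills.Theorems.UnitScaleTiltProp7NestedMeanTowerClosenessRefMean
import Summits.QuantumFields.YangMills.Theorems.UnitScaleTiltProp7BlockBumpExtensionFat
import Summits.QuantumFields.YangMills.Theorems.UnitScaleTiltProp7RightInverseSmoothAssembly
import Summits.QuantumFields.YangMills.Theorems.UnitScaleTiltProp7CovMeanTowerOnto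
import HarnessLib

/-!
# Route `UnitScaleTilt`, crux K1 child «MinimiserStabilityRegPr» (stmt-QuantumFields-19200), skeleton v10, stub `stub_existenceMinimalOrbit` (EX), route (α) —
# **«(P2)-KNIT-Y1», THE CURRENCY HALF: THE THREE (Y, 𝓚, q)-ROWS `hT`, `hQ4`, `hKT` OF ✓`Prop7LandauTransversalityPairing.htest_of_rows` ∕ ✓`Prop7HSplitDOfRows.hSplitD_of_rows`
# DISCHARGED AT THE COARSE CURRENCY OF RECORD (Y1′)** — `Y := Site (F.P K) (K−n) → M₂(ℂ)`, `𝓚 N := (y ↦ N(x̂⁽ᵏ⁾y) − V N y · ν_k(y)⁻¹)` (T5-A's frame-corrected gauge operator with the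
# LINEAR response letter `V`, ROW-V), `q c := ‖toL2S F n c₁ (c ∘ siteShift)‖` (`c₁ = c₀η⁻³`), for a chart point `U′ = e^{A₁}U₀`, `‖A₁‖ < eη`, both `RegPr`, under the windows of record
# AND the two tighter (hS) windows `10¹¹L²e ≤ 1`, `10¹⁴L³ε₀ ≤ 1` and the fat-bump room `100·η ≤ 1`:
# (T) ← ★px10 g2 ✓`Prop7FrameCorrectedKernelSlice.fderiv_logChartTwS_eq_zero_of_frameCorrected_eq_zero`; (T-small) `hKT` with `δ := √2·3∕10⁶` ← ★px6 g2 ✓`Prop7FrameCorrectedMinusMean`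
# (`norm_toL2S_shift_frameResponse_le_of_regPr_of_avgSeq_eq_zero`, `deltaT_le_tight`); (Q4-H²) `hQ4` ← ✓`Prop7ResolventSmoothing.hQ4_of_rows` (resolvent smoothing + ★px10's solve door) fed
# with ★px10's corner-axial framed fat bump ✓`Prop7BlockBumpExtension.exists_fatBlockBumpExtension` (`w = 1∕10`), ★px11 g2's bond row ✓`norm_axialGauge_bond_sub_one_le_T3` and nested-mean
# row ✓`norm_ns_sub_refMean_le_of_plaqSmall` ((d2)), ★px6's transfer rows ((d1), boundedness); the numeric outcome is `C₀·δ ≤ 1∕10`, so the knit's window `2·56e·(2 + 4C₀δ) + 4C₀δ < 1` holds.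
# ROW-V's ℂ-linear response letter `V` is DISCHARGED inside by ★px6 g2 ✓`Prop7FrameCorrectedMinusMean.exists_linear_frameResponse_of_regPr`; nothing but windows is displayed.

Cell `ym3-torus`, width seat `ym-ust-20520-w5` (gen 7).  THEOREMS ONLY (0 `def`, 0 `sorry`).  `--supports stmt-QuantumFields-19200 --as helper`, count-neutral.  YM₃ on T³ is a
ladder rung (R3), not the Clay problem; nothing here claims the stub, the crux, d = 4 or the mass gap.

References: T. Bałaban, CMP 99 (1985) 389–434 [Balaban1985BackgroundPropagators] ((3.8) p.392, (3.19)–(3.23) pp.393–394, (3.114)–(3.115) p.418); CMP 102 (1985) 277–309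
[Balaban1985Variational] ((45) p.285, (82)–(83) p.290); CMP 98 (1985) 17–51 [Balaban1985Averaging] ((97) p.32).
-/

set_option autoImplicit false

noncomputable section

open scoped BigOperators InnerProductSpace Matrix.Norms.L2Operator ComplexConjugate

namespace Summit.QuantumFields.YangMills.Theorems.Prop7LandauTransversalityRowsY1

open Literature.MathematicalPhysics.QuantumFieldTheory.Balaban1983to89
open Literature.MathematicalPhysics.QuantumFieldTheory.Balaban1983to89.T3ContinuumYM3Torus
open T4Continuum BlockAveraging
open B10Eq27TorusAxialLog (holT gaugeActT transl unitsField toUField axialT)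
open B7Prop1Explicit (expUnit val_expUnit disp U1 mem_U1)
open B7TransferAnalyticMean (meanCLM)
open B7Eq78Linearization (conjR)
open B5Eq118OneStroke (iterBlockOf iterBlock mem_iterBlock)
open B15DeterminingSets (embIter)
open T3LevelShift (siteShift)
open T3PrintedRegularOrbits (sites_eq)
open T3RegularMinimiser (regThreshold)
open T3PrintedRegularMinimiser (RegPr)
open T3SectALandauChart (eta eta_pos bgUnits)
open Literature.Analysis.Calculus.ExpDifferential (ad gSer)
open NormedSpace (exp)
open B11Eq103H1Complex (SiteL2K BondL2K)
open Summit.QuantumFields.YangMills.Theorems.Prop7SectET3Transport (periodsT3)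
open Summit.QuantumFields.YangMills.Theorems.Prop7SectET3HilbertLetters (W₂ toL2 toL2S DL2 DstarL2 covLapSite)
open Summit.QuantumFields.YangMills.Theorems.Prop7SectET3GaugeProjector (NS)
open Summit.QuantumFields.YangMills.Theorems.Prop7SymAvgTwSym (frameAccU logChartTwS pow_mul_eta_eq_one regThreshold_eq_mul_eta_sq)
open Summit.QuantumFields.YangMills.Theorems.Prop8Chart (emlIterU)
open Summit.QuantumFields.YangMills.Theorems.Prop7FrameCorrectedKernelSlice (fderiv_logChartTwS_eq_zero_of_frameCorrected_eq_zero)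
open Summit.QuantumFields.YangMills.Theorems.Prop7FrameCorrectedMinusMean (crs_frameResponse_sub_avgSeq_le_of_regPr crs_avgSeq_le_of_regPr normSq_toL2S_shift_eq
  norm_toL2S_shift_frameResponse_le_of_regPr_of_avgSeq_eq_zero deltaT_le_tight exists_linear_frameResponse_of_regPr)
open Summit.QuantumFields.YangMills.Theorems.Prop7NestedMeanTowerCloseness (norm_ns_sub_refMean_le_of_plaqSmall norm_axialGauge_bond_sub_one_le_T3)
open Summit.QuantumFields.YangMills.Theorems.Prop7BlockBumpExtension (exists_fatBlockBumpExtension)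
open Summit.QuantumFields.YangMills.Theorems.Prop7ResolventSmoothing (hQ4_of_rows)
open Summit.QuantumFields.YangMills.Theorems.Prop7CovMeanTowerOnto (exists_avgSeq)
open Summit.QuantumFields.YangMills.Theorems.Prop7CovariantCoercivity (sum_norm_sq_le_mul_opNorm_sq)

variable (F : T3Family) {n K : ℕ} (h : n ≤ K)

/-! ## §1 The frame-corrected gauge operator as a linear map -/

/-- **T5-A's FRAME-CORRECTED GAUGE OPERATOR `𝓚 N := (y ↦ N(x̂⁽ᵏ⁾y) − V N y·ν_k(y)⁻¹)` IS ℂ-LINEAR IN `N`** once the response letter `V` is (ROW-V); packaged def-free as `∃ Kop`.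
[cite: Balaban1985BackgroundPropagators, (3.19) p.393, (3.114) p.418] -/
theorem exists_Kop_linear (U₀ U' : GaugeField (F.P K) 0 (Matrix.specialUnitaryGroup (Fin 2) ℂ))
    (V : (Site (F.P K) 0 → Matrix (Fin 2) (Fin 2) ℂ) →ₗ[ℂ] (Site (F.P K) (K - n) → Matrix (Fin 2) (Fin 2) ℂ)) :
    ∃ Kop : (Site (F.P K) 0 → Matrix (Fin 2) (Fin 2) ℂ) →ₗ[ℂ] (Site (F.P K) (K - n) → Matrix (Fin 2) (Fin 2) ℂ),
      ∀ N y, Kop N y = N (embIter (K - n) y) - V N y * (((frameAccU (K - n) (bgUnits F K U₀) (bgUnits F K U') y)⁻¹ : (Matrix (Fin 2) (Fin 2) ℂ)ˣ) : Matrix (Fin 2) (Fin 2) ℂ) := by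
  refine ⟨{ toFun := fun N y => N (embIter (K - n) y) - V N y * (((frameAccU (K - n) (bgUnits F K U₀) (bgUnits F K U') y)⁻¹ : (Matrix (Fin 2) (Fin 2) ℂ)ˣ) : Matrix (Fin 2) (Fin 2) ℂ)
            map_add' := fun a b => ?_
            map_smul' := fun c a => ?_ }, fun N y => rfl⟩
  · funext y
    simp only [Pi.add_apply, map_add, add_mul]
    abel
  · funext y
    simp only [Pi.smul_apply, map_smul, RingHom.id_apply, smul_sub, Matrix.smul_mul]

/-! ## §2 The numerics of the (hS) window -/

/-- `√2 ≤ 3∕2` and `√6 ≤ 5∕2`. [folklore] -/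
private theorem sqrt_two_le : Real.sqrt 2 ≤ 3 / 2 ∧ Real.sqrt 6 ≤ 5 / 2 := by
  constructor
  · have h1 : Real.sqrt 2 ≤ Real.sqrt ((3 / 2) ^ 2) := Real.sqrt_le_sqrt (by norm_num)
    rwa [Real.sqrt_sq (by norm_num)] at h1
  · have h1 : Real.sqrt 6 ≤ Real.sqrt ((5 / 2) ^ 2) := Real.sqrt_le_sqrt (by norm_num)
    rwa [Real.sqrt_sq (by norm_num)] at h1

/-- **THE WINDOW ARITHMETIC** (all letters bounded by rationals): with `κ ≥ (39∕50)³`, `θ₀κ ≤ 10⁻⁵`, `C_𝓚 ≤ 3∕2`, `s₀ = 3∕2`, `s₁ = 26`, `√(t∕2) = 1∕150`, `√(2t) = 1∕75`,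
`δ = √2·3∕10⁶`: `θ := θ₀ + C_𝓚·(1∕150)·26∕κ < 1` and `C₀·δ ≤ 1∕10` for `C₀ := (s₀ + s₁ + s₁∕(1∕75))∕(κ(1 − θ))`. [folklore] -/
private theorem window_numerics {κ θ₀ CK : ℝ} (hκ : (39 / 50 : ℝ) ^ 3 ≤ κ) (hθ₀' : θ₀ * κ ≤ 1 / 10 ^ 5) (hCK : CK ≤ 3 / 2) :
    θ₀ + CK * ((1 / 150 : ℝ) * 26) / κ < 1 ∧
      0 ≤ (3 / 2 + 26 + 26 / (1 / 75 : ℝ)) / (κ * (1 - (θ₀ + CK * ((1 / 150 : ℝ) * 26) / κ))) ∧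
      (3 / 2 + 26 + 26 / (1 / 75 : ℝ)) / (κ * (1 - (θ₀ + CK * ((1 / 150 : ℝ) * 26) / κ))) * (Real.sqrt 2 * (3 / 10 ^ 6)) ≤ 1 / 10 := by
  have hκ0 : 0 < κ := lt_of_lt_of_le (by norm_num) hκ
  have hκv : (0.474 : ℝ) ≤ κ := le_trans (by norm_num) hκ
  -- `κ(1 − θ) = κ − θ₀κ − C_𝓚·26∕150 ≥ 1∕5`
  have hden : κ * (1 - (θ₀ + CK * ((1 / 150 : ℝ) * 26) / κ)) = κ - θ₀ * κ - CK * (26 / 150) := by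
    field_simp
    ring
  have hden5 : (1 / 5 : ℝ) ≤ κ * (1 - (θ₀ + CK * ((1 / 150 : ℝ) * 26) / κ)) := by
    rw [hden]; nlinarith
  have hdenpos : 0 < κ * (1 - (θ₀ + CK * ((1 / 150 : ℝ) * 26) / κ)) := lt_of_lt_of_le (by norm_num) hden5
  refine ⟨?_, ?_, ?_⟩
  · -- `θ < 1` from `κ(1 − θ) > 0`
    by_contra hθ
    rw [not_lt] at hθ
    have : κ * (1 - (θ₀ + CK * ((1 / 150 : ℝ) * 26) / κ)) ≤ 0 := mul_nonpos_of_nonneg_of_nonpos hκ0.le (by linarith)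
    linarith
  · exact div_nonneg (by norm_num) hdenpos.le
  · have hnum : (3 / 2 + 26 + 26 / (1 / 75 : ℝ)) = 3955 / 2 := by norm_num
    rw [hnum]
    have hs2 : Real.sqrt 2 ≤ 3 / 2 := sqrt_two_le.1
    have hC₀ : (3955 / 2 : ℝ) / (κ * (1 - (θ₀ + CK * ((1 / 150 : ℝ) * 26) / κ))) ≤ (3955 / 2) / (1 / 5) :=
      div_le_div_of_nonneg_left (by norm_num) (by norm_num) hden5
    calc (3955 / 2 : ℝ) / (κ * (1 - (θ₀ + CK * ((1 / 150 : ℝ) * 26) / κ))) * (Real.sqrt 2 * (3 / 10 ^ 6))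
        ≤ (3955 / 2) / (1 / 5) * ((3 / 2) * (3 / 10 ^ 6)) := by
          refine mul_le_mul hC₀ (mul_le_mul_of_nonneg_right hs2 (by norm_num)) (by positivity) (by norm_num)
      _ ≤ 1 / 10 := by norm_num

/-! ## §3 The three currency rows at (Y1′) -/

set_option maxHeartbeats 400000 in
/-- ★★★ **«(P2)-KNIT-Y1» — THE THREE (Y, 𝓚, q)-ROWS OF ✓`htest_of_rows` ∕ ✓`hSplitD_of_rows` AT THE COARSE CURRENCY OF RECORD.**  For a chart point `U′ = e^{A₁}U₀` (`RegPr ε₀ U₀`,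
`RegPr ε₀′ U′`, `‖A₁‖ < eη`) under the windows of record, the two tighter (hS) windows `10¹¹L²e ≤ 1`, `10¹⁴L³ε₀ ≤ 1` and the fat-bump room `100η ≤ 1`, with ROW-V's ℂ-linear response
letter `V` (✓`exists_linear_frameResponse_of_regPr`) obtained inside: there are a ℂ-linear `𝓚` (T5-A's frame-corrected gauge operator, `𝓚 N y = N(x̂⁽ᵏ⁾y) − V N y·ν_k(y)⁻¹`) and constants `C₀, δ ≥ 0` with `C₀·δ ≤ 1∕10` such that,
with `q c := ‖toL2S F n c₁ (c ∘ siteShift)‖` (`c₁ = c₀η⁻³`): (T) `M w = Gd N′ ∧ 𝓚 N′ = 0 ⟹ fderiv logChartTwS A₁ w = 0`; (Q4-H²) `∀ m, ∃ N, 𝓚 N = m ∧ ‖toL2S N‖, ‖D_{U₀}(toL2S N)‖, ‖Δ^η_{U₀}(toL2S N)‖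
≤ C₀·q m`; (T-small) on the sector «nested mean ends at 0»: `q(𝓚 l₁) ≤ δ·(‖toL2S l₁‖ + ‖D_{U₀}(toL2S l₁)‖)`.  [cite: Balaban1985BackgroundPropagators, (3.19)–(3.23) pp.393–394, (3.114)–(3.115)
p.418; Balaban1985Variational, (45) p.285, (82)–(83) p.290; Balaban1985Averaging, (97) p.32] -/
theorem exists_rowsY1 {c₀ c₁ : ℝ} [Fact (0 < c₀)] [Fact (0 < c₁)] (hc₁ : c₁ = c₀ * (eta F n K)⁻¹ ^ 3) (cB : ℝ)
    {ε₀ ε₀' e : ℝ} (hε₀ : 0 < ε₀) (he : 0 < e) (hWe : 10 ^ 9 * (F.L : ℝ) ^ 2 * e ≤ 1) (hWε : 10 ^ 12 * (F.L : ℝ) ^ 3 * ε₀ ≤ 1)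
    (hWe' : 10 ^ 11 * (F.L : ℝ) ^ 2 * e ≤ 1) (hWε' : 10 ^ 14 * (F.L : ℝ) ^ 3 * ε₀ ≤ 1) (hε₀' : 0 < ε₀') (hε' : 10 ^ 7 * (F.L : ℝ) ^ 3 * ε₀' ≤ 1)
    (hη : 100 * eta F n K ≤ 1)
    (U₀ U' : GaugeField (F.P K) 0 (Matrix.specialUnitaryGroup (Fin 2) ℂ)) (hreg : RegPr F n K ε₀ U₀) (hreg' : RegPr F n K ε₀' U')
    (A₁ : PBond (F.P K) 0 → Matrix (Fin 2) (Fin 2) ℂ) (hA₁ : ‖A₁‖ < e * eta F n K)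
    (hU' : ∀ b, ((U' b : Matrix.specialUnitaryGroup (Fin 2) ℂ) : Matrix (Fin 2) (Fin 2) ℂ) = exp (A₁ b) * ((U₀ b : Matrix.specialUnitaryGroup (Fin 2) ℂ) : Matrix (Fin 2) (Fin 2) ℂ)) :
    ∃ (Kop : (Site (F.P K) 0 → Matrix (Fin 2) (Fin 2) ℂ) →ₗ[ℂ] (Site (F.P K) (K - n) → Matrix (Fin 2) (Fin 2) ℂ)) (C₀ δ : ℝ),
      0 ≤ C₀ ∧ 0 ≤ δ ∧ C₀ * δ ≤ 1 / 10 ∧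
      (∀ (N' : Site (F.P K) 0 → Matrix (Fin 2) (Fin 2) ℂ) (w : PBond (F.P K) 0 → Matrix (Fin 2) (Fin 2) ℂ),
        (∀ b, gSer ℂ (ad ℂ (-A₁ b)) (w b) = N' b.src - ((bgUnits F K U' b : (Matrix (Fin 2) (Fin 2) ℂ)ˣ) : Matrix (Fin 2) (Fin 2) ℂ) * N' b.tgt *
          (((bgUnits F K U' b)⁻¹ : (Matrix (Fin 2) (Fin 2) ℂ)ˣ) : Matrix (Fin 2) (Fin 2) ℂ)) →
        Kop N' = 0 → fderiv ℂ (logChartTwS F n K h U₀) A₁ w = 0) ∧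
      (∀ m : Site (F.P K) (K - n) → Matrix (Fin 2) (Fin 2) ℂ, ∃ N : Site (F.P K) 0 → Matrix (Fin 2) (Fin 2) ℂ, Kop N = m ∧
        ‖toL2S F K c₀ N‖ ≤ C₀ * ‖toL2S F n c₁ (fun y' : Site (F.P n) 0 => m (siteShift (sites_eq F n K h) y'))‖ ∧
        ‖DL2 F n K c₀ U₀ (toL2S F K c₀ N)‖ ≤ C₀ * ‖toL2S F n c₁ (fun y' : Site (F.P n) 0 => m (siteShift (sites_eq F n K h) y'))‖ ∧
        ‖covLapSite F n K c₀ U₀ (toL2S F K c₀ N)‖ ≤ C₀ * ‖toL2S F n c₁ (fun y' : Site (F.P n) 0 => m (siteShift (sites_eq F n K h) y'))‖) ∧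
      (∀ l₁ : Site (F.P K) 0 → Matrix (Fin 2) (Fin 2) ℂ, toL2S F K c₀ l₁ ∈ NS F n K h c₀ cB U₀ →
        (∃ ns : (j : ℕ) → Site (F.P K) j → Matrix (Fin 2) (Fin 2) ℂ, ns 0 = l₁ ∧
          (∀ (j : ℕ) (y : Site (F.P K) (j + 1)), ns (j + 1) y = ns j (emb y) - meanCLM (Idx (F.P K)) (Matrix (Fin 2) (Fin 2) ℂ) fun i : Idx (F.P K) =>
            ns j (emb y) - ((holT (emlIterU j (bgUnits F K U₀)) (emb y) (stairWord i.2.1 (off i.1)) : (Matrix (Fin 2) (Fin 2) ℂ)ˣ) : Matrix (Fin 2) (Fin 2) ℂ) *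
              ns j (transl (emb y) (disp (stairWord i.2.1 (off i.1)))) * (((holT (emlIterU j (bgUnits F K U₀)) (emb y) (stairWord i.2.1 (off i.1)))⁻¹ : (Matrix (Fin 2) (Fin 2) ℂ)ˣ) : Matrix (Fin 2) (Fin 2) ℂ)) ∧
          ∀ y, ns (K - n) y = 0) →
        ‖toL2S F n c₁ (fun y' : Site (F.P n) 0 => Kop l₁ (siteShift (sites_eq F n K h) y'))‖ ≤ δ * (‖toL2S F K c₀ l₁‖ + ‖DL2 F n K c₀ U₀ (toL2S F K c₀ l₁)‖)) := by
  have hη0 : 0 < eta F n K := eta_pos F n K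
  have hηle : eta F n K ≤ 1 / 100 := by linarith
  have hL1 : (1 : ℝ) ≤ F.L := by have := F.hL.2; exact_mod_cast (show 1 ≤ F.L by omega)
  have hpow : (F.L : ℝ) ^ (K - n) * eta F n K = 1 := pow_mul_eta_eq_one F
  -- ROW-V (★px6 g2): the ℂ-linear response letter `V`
  obtain ⟨V, hV⟩ := exists_linear_frameResponse_of_regPr F hε₀ he hWe hWε hε₀' hε' U₀ U' hreg hreg' A₁ hA₁ hU'
  obtain ⟨Kop, hKop⟩ := exists_Kop_linear F (n := n) U₀ U' V
  -- the curves `t ↦ exp(tN)` and their derivative rows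
  have hg0 : ∀ N : Site (F.P K) 0 → Matrix (Fin 2) (Fin 2) ℂ, (fun t : ℝ => fun z : Site (F.P K) 0 => expUnit (t • N z)) 0 = fun _ => 1 := fun N => by
    funext z; apply Units.ext; rw [val_expUnit, zero_smul, NormedSpace.exp_zero, Units.val_one]
  have hgd : ∀ (N : Site (F.P K) 0 → Matrix (Fin 2) (Fin 2) ℂ) (z : Site (F.P K) 0),
      HasDerivAt (fun t : ℝ => (((fun t : ℝ => fun z : Site (F.P K) 0 => expUnit (t • N z)) t z : (Matrix (Fin 2) (Fin 2) ℂ)ˣ) : Matrix (Fin 2) (Fin 2) ℂ)) (N z) 0 := fun N z => by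
    have h1 := hasDerivAt_exp_smul_const' (𝕂 := ℝ) (N z) (0 : ℝ)
    simp only [zero_smul, NormedSpace.exp_zero, mul_one] at h1
    have hfun : (fun t : ℝ => (((fun t : ℝ => fun z : Site (F.P K) 0 => expUnit (t • N z)) t z : (Matrix (Fin 2) (Fin 2) ℂ)ˣ) : Matrix (Fin 2) (Fin 2) ℂ)) = fun t => exp (t • N z) := by
      funext t; exact val_expUnit _
    rw [hfun]; exact h1
  -- the transporter tower of the background and its averaging sequences
  set T : (j : ℕ) → Site (F.P K) (j + 1) → Idx (F.P K) → (Matrix (Fin 2) (Fin 2) ℂ)ˣ :=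
    fun j y i => holT (emlIterU j (bgUnits F K U₀)) (emb y) (stairWord i.2.1 (off i.1)) with hTdef
  -- `δT := 3/10⁶` under the tighter windows
  have hδT : 2 * (240 * (F.L : ℝ) + 19560 * (F.L : ℝ) ^ 3) * (2 * e + 2700 * (F.L : ℝ) * ε₀) / ((F.L : ℝ) - 1) ≤ 3 / 10 ^ 6 :=
    deltaT_le_tight F hε₀ he.le hWe' hWε'
  -- the coarse size `q` and its gauge axioms
  set Φ : (Site (F.P K) (K - n) → Matrix (Fin 2) (Fin 2) ℂ) →ₗ[ℂ] SiteL2K ℂ 3 (periodsT3 F n) c₁ W₂ :=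
    (toL2S F n c₁ : (Site (F.P n) 0 → Matrix (Fin 2) (Fin 2) ℂ) ≃ₗ[ℂ] SiteL2K ℂ 3 (periodsT3 F n) c₁ W₂).toLinearMap ∘ₗ
      LinearMap.funLeft ℂ (Matrix (Fin 2) (Fin 2) ℂ) (siteShift (sites_eq F n K h)) with hΦdef
  have hΦapp : ∀ m, Φ m = toL2S F n c₁ (fun y' : Site (F.P n) 0 => m (siteShift (sites_eq F n K h) y')) := fun m => rfl
  set q : (Site (F.P K) (K - n) → Matrix (Fin 2) (Fin 2) ℂ) → ℝ := fun m => ‖Φ m‖ with hqdef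
  have hq_add : ∀ a b, q (a + b) ≤ q a + q b := fun a b => by simp only [hqdef, map_add]; exact norm_add_le _ _
  have hq_smul : ∀ (r : ℝ) (a : Site (F.P K) (K - n) → Matrix (Fin 2) (Fin 2) ℂ), q (((r : ℝ) : ℂ) • a) = |r| * q a := fun r a => by
    simp only [hqdef, map_smul, norm_smul, Complex.norm_real, Real.norm_eq_abs]
  have hq_def : ∀ a, q a = 0 → a = 0 := fun a ha => by
    have h1 : Φ a = 0 := norm_eq_zero.1 ha
    have h2 : LinearMap.funLeft ℂ (Matrix (Fin 2) (Fin 2) ℂ) (siteShift (sites_eq F n K h)) a = 0 := by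
      have := h1; rw [hΦdef, LinearMap.comp_apply] at this
      exact (LinearEquiv.map_eq_zero_iff _).1 this
    exact LinearMap.funLeft_injective_of_surjective ℂ _ _ (siteShift (sites_eq F n K h)).surjective (h2.trans (map_zero _).symm)
  have hq_nonneg : ∀ a, 0 ≤ q a := fun a => norm_nonneg _
  -- `q m = √(c₀η⁻³ Σ_y Σ_jk |m y j k|²)`
  have hq_eq : ∀ m, q m = Real.sqrt (c₀ * (eta F n K)⁻¹ ^ 3 * ∑ y : Site (F.P K) (K - n), ∑ j : Fin 2, ∑ k : Fin 2, ‖m y j k‖ ^ 2) := fun m => by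
    show ‖Φ m‖ = _
    rw [hΦapp, ← Real.sqrt_sq (norm_nonneg (toL2S F n c₁ _)), normSq_toL2S_shift_eq F h, hc₁]
  have hε7 : 10 ^ 7 * (F.L : ℝ) ^ 3 * ε₀ ≤ 1 := by
    have : 0 ≤ (F.L : ℝ) ^ 3 * ε₀ := by positivity
    nlinarith
  /- (T) the kernel row (★px10 g2 ROW-G) -/
  have HT : ∀ (N' : Site (F.P K) 0 → Matrix (Fin 2) (Fin 2) ℂ) (w : PBond (F.P K) 0 → Matrix (Fin 2) (Fin 2) ℂ),
      (∀ b, gSer ℂ (ad ℂ (-A₁ b)) (w b) = N' b.src - ((bgUnits F K U' b : (Matrix (Fin 2) (Fin 2) ℂ)ˣ) : Matrix (Fin 2) (Fin 2) ℂ) * N' b.tgt *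
        (((bgUnits F K U' b)⁻¹ : (Matrix (Fin 2) (Fin 2) ℂ)ˣ) : Matrix (Fin 2) (Fin 2) ℂ)) →
      Kop N' = 0 → fderiv ℂ (logChartTwS F n K h U₀) A₁ w = 0 := by
    intro N' w hw hK0
    refine fderiv_logChartTwS_eq_zero_of_frameCorrected_eq_zero F h hε₀ he hWe hWε hε₀' hε' U₀ U' hreg hreg' A₁ hA₁ hU' N' (V N') (hV N') (fun x => ?_) w hw
    have h1 := congr_fun hK0 x
    rw [hKop] at h1
    exact h1
  /- (T-small) the transfer row on the sector (★px6 g2 R2t) -/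
  have HKT : ∀ l₁ : Site (F.P K) 0 → Matrix (Fin 2) (Fin 2) ℂ, toL2S F K c₀ l₁ ∈ NS F n K h c₀ cB U₀ →
      (∃ ns : (j : ℕ) → Site (F.P K) j → Matrix (Fin 2) (Fin 2) ℂ, ns 0 = l₁ ∧
        (∀ (j : ℕ) (y : Site (F.P K) (j + 1)), ns (j + 1) y = ns j (emb y) - meanCLM (Idx (F.P K)) (Matrix (Fin 2) (Fin 2) ℂ) fun i : Idx (F.P K) =>
          ns j (emb y) - ((holT (emlIterU j (bgUnits F K U₀)) (emb y) (stairWord i.2.1 (off i.1)) : (Matrix (Fin 2) (Fin 2) ℂ)ˣ) : Matrix (Fin 2) (Fin 2) ℂ) *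
            ns j (transl (emb y) (disp (stairWord i.2.1 (off i.1)))) * (((holT (emlIterU j (bgUnits F K U₀)) (emb y) (stairWord i.2.1 (off i.1)))⁻¹ : (Matrix (Fin 2) (Fin 2) ℂ)ˣ) : Matrix (Fin 2) (Fin 2) ℂ)) ∧
        ∀ y, ns (K - n) y = 0) →
      ‖toL2S F n c₁ (fun y' : Site (F.P n) 0 => Kop l₁ (siteShift (sites_eq F n K h) y'))‖
        ≤ Real.sqrt 2 * (3 / 10 ^ 6) * (‖toL2S F K c₀ l₁‖ + ‖DL2 F n K c₀ U₀ (toL2S F K c₀ l₁)‖) := by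
    intro l₁ _ hZ
    obtain ⟨ns, h0, hsucc, hz⟩ := hZ
    have hmain := norm_toL2S_shift_frameResponse_le_of_regPr_of_avgSeq_eq_zero F h hε₀ he hWe hWε hε₀' hε' U₀ U' hreg hreg' A₁ hA₁ hU'
      (hg0 l₁) (hgd l₁) ns h0 hsucc hz (hV l₁) hδT hc₁
    have hfun : (fun y' : Site (F.P n) 0 => Kop l₁ (siteShift (sites_eq F n K h) y')) = fun y' : Site (F.P n) 0 =>
        l₁ (embIter (K - n) (siteShift (sites_eq F n K h) y')) - V l₁ (siteShift (sites_eq F n K h) y') *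
          (((frameAccU (K - n) (bgUnits F K U₀) (bgUnits F K U') (siteShift (sites_eq F n K h) y'))⁻¹ : (Matrix (Fin 2) (Fin 2) ℂ)ˣ) : Matrix (Fin 2) (Fin 2) ℂ) :=
      funext fun y' => hKop l₁ _
    rw [hfun]
    exact hmain
  /- (Q4-H²): the fat framed bump (★px10 g2) on ★px11 g2's corner-axial frame -/
  have hsb0 : 0 ≤ 2 * ((3 : ℝ) * ((F.L : ℝ) ^ (K - n) - 1)) * regThreshold F n K ε₀ := by
    have h1 : (1 : ℝ) ≤ (F.L : ℝ) ^ (K - n) := one_le_pow₀ hL1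
    have h2 : 0 ≤ regThreshold F n K ε₀ := by rw [regThreshold_eq_mul_eta_sq]; positivity
    have h3 : (0 : ℝ) ≤ (F.L : ℝ) ^ (K - n) - 1 := by linarith
    positivity
  obtain ⟨S, χ, κ, hSf, hS0, hS1, hχ01, hχsh, hχun, hχlip, hi, hii, hiii, hκlo, hκhi⟩ :=
    exists_fatBlockBumpExtension F h hc₁ U₀ (fun Y : Site (F.P K) (K - n) => Site.fibreSite 0 (K - n) Y fun _ => (⟨0, pow_pos (F.P K).L_pos (K - n)⟩ : Fin ((F.P K).L ^ (K - n))))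
      (w := 1 / 10) (by norm_num) (by linarith) hsb0 (fun Y b hb hb' => norm_axialGauge_bond_sub_one_le_T3 F hε₀ U₀ hreg.1 Y b hb hb')
  have hκlo' : (39 / 50 : ℝ) ^ 3 ≤ κ := by
    have h1 : (39 / 50 : ℝ) ≤ 1 - 2 * (1 / 10) - 2 * eta F n K := by linarith
    exact le_trans (pow_le_pow_left₀ (by norm_num) h1 3) hκlo
  have hκ0 : 0 < κ := lt_of_lt_of_le (by norm_num) hκlo'
  -- (H⁰), (H¹) with rational constants `s₀ = 3/2`, `s₁ = 26`
  have HS0 : ∀ c, ‖toL2S F K c₀ (S c)‖ ≤ (3 / 2) * q c := fun c =>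
    (hS0 c).trans (mul_le_mul_of_nonneg_right sqrt_two_le.1 (norm_nonneg _))
  have hs₁ : Real.sqrt 6 * ((2 * (2 * ((3 : ℝ) * ((F.L : ℝ) ^ (K - n) - 1)) * regThreshold F n K ε₀) + eta F n K / (1 / 10)) / eta F n K) ≤ 26 := by
    -- `regThreshold = ε₀η²`, `(L^k − 1)·η ≤ 1`, so the bond part is `≤ 24ε₀ ≤ 10⁻¹²`
    have hreg_eq : regThreshold F n K ε₀ = ε₀ * eta F n K ^ 2 := regThreshold_eq_mul_eta_sq F ε₀
    have h1 : ((F.L : ℝ) ^ (K - n) - 1) * eta F n K ≤ 1 := by nlinarith [hpow, hη0]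
    have h1' : 0 ≤ ((F.L : ℝ) ^ (K - n) - 1) := by linarith [one_le_pow₀ (n := K - n) hL1]
    have hε₀1 : ε₀ ≤ 1 / 10 ^ 14 := by
      have hL3 : (1 : ℝ) ≤ (F.L : ℝ) ^ 3 := one_le_pow₀ hL1
      nlinarith
    have hfrac : (2 * (2 * ((3 : ℝ) * ((F.L : ℝ) ^ (K - n) - 1)) * regThreshold F n K ε₀) + eta F n K / (1 / 10)) / eta F n K
        = 12 * (((F.L : ℝ) ^ (K - n) - 1) * eta F n K) * ε₀ + 10 := by
      rw [hreg_eq]; field_simp; ring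
    rw [hfrac]
    have h2 : 12 * (((F.L : ℝ) ^ (K - n) - 1) * eta F n K) * ε₀ + 10 ≤ 52 / 5 := by
      have : ((F.L : ℝ) ^ (K - n) - 1) * eta F n K * ε₀ ≤ 1 * (1 / 10 ^ 14) :=
        mul_le_mul h1 hε₀1 hε₀.le zero_le_one
      linarith
    calc Real.sqrt 6 * (12 * (((F.L : ℝ) ^ (K - n) - 1) * eta F n K) * ε₀ + 10) ≤ (5 / 2) * (52 / 5) :=
          mul_le_mul sqrt_two_le.2 h2 (by positivity) (by norm_num)
      _ = 26 := by norm_num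
  have HS1 : ∀ c, ‖DL2 F n K c₀ U₀ (toL2S F K c₀ (S c))‖ ≤ 26 * q c := fun c =>
    (hS1 c).trans (mul_le_mul_of_nonneg_right hs₁ (norm_nonneg _))
  -- the `q`-size of a coarse field through its pointwise operator norms
  have hq_le_of_pointwise : ∀ (m c : Site (F.P K) (K - n) → Matrix (Fin 2) (Fin 2) ℂ) (a : ℝ), 0 ≤ a → (∀ y, ‖m y‖ ≤ a * ‖c y‖) →
      q m ≤ Real.sqrt 2 * a * q c := by
    intro m c a ha hm
    have hc0 : 0 < c₀ := Fact.out
    rw [hq_eq m, hq_eq c]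
    have hF : ∀ y, ∑ j : Fin 2, ∑ k : Fin 2, ‖m y j k‖ ^ 2 ≤ 2 * (a * ‖c y‖) ^ 2 := fun y => by
      have h1 := sum_norm_sq_le_mul_opNorm_sq (N := 2) (m y)
      have h2 : ‖m y‖ ^ 2 ≤ (a * ‖c y‖) ^ 2 := pow_le_pow_left₀ (norm_nonneg _) (hm y) 2
      calc ∑ j : Fin 2, ∑ k : Fin 2, ‖m y j k‖ ^ 2 ≤ 2 * ‖m y‖ ^ 2 := by simpa using h1
        _ ≤ 2 * (a * ‖c y‖) ^ 2 := by linarith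
    have hop : ∀ y, ‖c y‖ ^ 2 ≤ ∑ j : Fin 2, ∑ k : Fin 2, ‖c y j k‖ ^ 2 := fun y => MatrixNorms.opNorm_sq_le_sum_norm_sq (c y)
    have hsum : c₀ * (eta F n K)⁻¹ ^ 3 * ∑ y : Site (F.P K) (K - n), ∑ j : Fin 2, ∑ k : Fin 2, ‖m y j k‖ ^ 2
        ≤ (Real.sqrt 2 * a) ^ 2 * (c₀ * (eta F n K)⁻¹ ^ 3 * ∑ y : Site (F.P K) (K - n), ∑ j : Fin 2, ∑ k : Fin 2, ‖c y j k‖ ^ 2) := by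
      rw [mul_pow, Real.sq_sqrt (by norm_num : (0:ℝ) ≤ 2)]
      have hw0 : 0 ≤ c₀ * (eta F n K)⁻¹ ^ 3 := by positivity
      calc c₀ * (eta F n K)⁻¹ ^ 3 * ∑ y : Site (F.P K) (K - n), ∑ j : Fin 2, ∑ k : Fin 2, ‖m y j k‖ ^ 2
          ≤ c₀ * (eta F n K)⁻¹ ^ 3 * ∑ y : Site (F.P K) (K - n), 2 * (a * ‖c y‖) ^ 2 :=
            mul_le_mul_of_nonneg_left (Finset.sum_le_sum fun y _ => hF y) hw0
        _ = 2 * a ^ 2 * (c₀ * (eta F n K)⁻¹ ^ 3 * ∑ y : Site (F.P K) (K - n), ‖c y‖ ^ 2) := by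
            rw [Finset.mul_sum, Finset.mul_sum, Finset.mul_sum]; refine Finset.sum_congr rfl fun y _ => ?_; ring
        _ ≤ 2 * a ^ 2 * (c₀ * (eta F n K)⁻¹ ^ 3 * ∑ y : Site (F.P K) (K - n), ∑ j : Fin 2, ∑ k : Fin 2, ‖c y j k‖ ^ 2) := by
            refine mul_le_mul_of_nonneg_left (mul_le_mul_of_nonneg_left (Finset.sum_le_sum fun y _ => hop y) hw0) (by positivity)
    calc Real.sqrt (c₀ * (eta F n K)⁻¹ ^ 3 * ∑ y : Site (F.P K) (K - n), ∑ j : Fin 2, ∑ k : Fin 2, ‖m y j k‖ ^ 2)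
        ≤ Real.sqrt ((Real.sqrt 2 * a) ^ 2 * (c₀ * (eta F n K)⁻¹ ^ 3 * ∑ y : Site (F.P K) (K - n), ∑ j : Fin 2, ∑ k : Fin 2, ‖c y j k‖ ^ 2)) :=
          Real.sqrt_le_sqrt hsum
      _ = Real.sqrt 2 * a * Real.sqrt (c₀ * (eta F n K)⁻¹ ^ 3 * ∑ y : Site (F.P K) (K - n), ∑ j : Fin 2, ∑ k : Fin 2, ‖c y j k‖ ^ 2) := by
          rw [Real.sqrt_mul (sq_nonneg _), Real.sqrt_sq (by positivity)]
  -- the `q`-size of `Kop N − ns_{K−n}` ((d1), ★px6) and of `ns_{K−n}` (boundedness, ★px6), for any averaging sequence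
  have hd1 : ∀ (N : Site (F.P K) 0 → Matrix (Fin 2) (Fin 2) ℂ) (ns : (j : ℕ) → Site (F.P K) j → Matrix (Fin 2) (Fin 2) ℂ), ns 0 = N →
      (∀ (j : ℕ) (y : Site (F.P K) (j + 1)), ns (j + 1) y = ns j (emb y) - meanCLM (Idx (F.P K)) (Matrix (Fin 2) (Fin 2) ℂ) fun i : Idx (F.P K) =>
          ns j (emb y) - ((holT (emlIterU j (bgUnits F K U₀)) (emb y) (stairWord i.2.1 (off i.1)) : (Matrix (Fin 2) (Fin 2) ℂ)ˣ) : Matrix (Fin 2) (Fin 2) ℂ) *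
            ns j (transl (emb y) (disp (stairWord i.2.1 (off i.1)))) * (((holT (emlIterU j (bgUnits F K U₀)) (emb y) (stairWord i.2.1 (off i.1)))⁻¹ : (Matrix (Fin 2) (Fin 2) ℂ)ˣ) : Matrix (Fin 2) (Fin 2) ℂ)) →
      q (Kop N - ns (K - n)) ≤ Real.sqrt 2 * (3 / 10 ^ 6) * ‖toL2S F K c₀ N‖ ∧ q (ns (K - n)) ≤ Real.sqrt 2 * ‖toL2S F K c₀ N‖ := by
    intro N ns h0 hsucc
    have h1 := (crs_frameResponse_sub_avgSeq_le_of_regPr F hε₀ he hWe hWε hε₀' hε' U₀ U' hreg hreg' A₁ hA₁ hU' (hg0 N) (hgd N) ns h0 hsucc (hV N) hδT (c₀ := c₀)).2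
    have h2 := (crs_avgSeq_le_of_regPr F hε₀ hε7 U₀ hreg ns h0 hsucc (c₀ := c₀)).2
    refine ⟨?_, ?_⟩
    · rw [hq_eq]
      have hfun : ∀ y j k, (Kop N - ns (K - n)) y j k = ((N (embIter (K - n) y) - V N y * (((frameAccU (K - n) (bgUnits F K U₀) (bgUnits F K U') y)⁻¹ :
          (Matrix (Fin 2) (Fin 2) ℂ)ˣ) : Matrix (Fin 2) (Fin 2) ℂ)) - ns (K - n) y) j k := fun y j k => by rw [Pi.sub_apply, hKop]
      simp_rw [hfun]
      exact h1
    · rw [hq_eq]; exact h2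
  -- boundedness `q(𝓚 g) ≤ √2(1 + 3/10⁶)·‖toL2S g‖`
  have HK : ∀ g : Site (F.P K) 0 → Matrix (Fin 2) (Fin 2) ℂ, q (Kop g) ≤ Real.sqrt 2 * (1 + 3 / 10 ^ 6) * ‖toL2S F K c₀ g‖ := by
    intro g
    obtain ⟨ns, h0, hsucc⟩ := exists_avgSeq (fun j (y : Site (F.P K) (j + 1)) (i : Idx (F.P K)) => holT (emlIterU j (bgUnits F K U₀)) (emb y) (stairWord i.2.1 (off i.1))) g
    obtain ⟨ha, hb⟩ := hd1 g ns h0 hsucc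
    have hsplit : Kop g = (Kop g - ns (K - n)) + ns (K - n) := by abel
    calc q (Kop g) = q ((Kop g - ns (K - n)) + ns (K - n)) := by rw [← hsplit]
      _ ≤ q (Kop g - ns (K - n)) + q (ns (K - n)) := hq_add _ _
      _ ≤ Real.sqrt 2 * (3 / 10 ^ 6) * ‖toL2S F K c₀ g‖ + Real.sqrt 2 * ‖toL2S F K c₀ g‖ := add_le_add ha hb
      _ = Real.sqrt 2 * (1 + 3 / 10 ^ 6) * ‖toL2S F K c₀ g‖ := by ring
  -- approximate identity `q(𝓚(S c) − κ•c) ≤ θ₀κ·q c`, `θ₀κ := 27/4/10⁶ + (3/2)·4500L²ε₀·κ` ((d1) ★px6 + (d2) ★px11∕★px20 + (ii),(iii) ★px10)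
  have HAPP : ∀ c : Site (F.P K) (K - n) → Matrix (Fin 2) (Fin 2) ℂ,
      q (Kop (S c) - ((κ : ℝ) : ℂ) • c) ≤ ((27 / 4 / 10 ^ 6 + (3 / 2) * (4500 * (F.L : ℝ) ^ 2 * ε₀) * κ) / κ) * κ * q c := by
    intro c
    obtain ⟨ns, h0, hsucc⟩ := exists_avgSeq (fun j (y : Site (F.P K) (j + 1)) (i : Idx (F.P K)) => holT (emlIterU j (bgUnits F K U₀)) (emb y) (stairWord i.2.1 (off i.1))) (S c)
    obtain ⟨ha, -⟩ := hd1 (S c) ns h0 hsucc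
    -- (d2) pointwise: nested mean vs `κ • c y`
    have hd2 : ∀ y : Site (F.P K) (K - n), ‖(ns (K - n) - ((κ : ℝ) : ℂ) • c) y‖ ≤ (4500 * (F.L : ℝ) ^ 2 * ε₀ * κ) * ‖c y‖ := fun y => by
      have h1 := norm_ns_sub_refMean_le_of_plaqSmall F hε₀ hε7 U₀ hreg.1 ns (S c) h0 hsucc (K - n) le_rfl y
      rw [hii c y] at h1
      rw [Pi.sub_apply, Pi.smul_apply, Complex.coe_smul]
      calc ‖ns (K - n) y - κ • c y‖ ≤ (4500 * (F.L : ℝ) ^ 2 * ε₀) * ((((((F.P K).L : ℝ) ^ (F.P K).d) ^ (K - n))⁻¹) * ∑ x ∈ iterBlock (K - n) y, ‖S c x‖) := h1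
        _ = (4500 * (F.L : ℝ) ^ 2 * ε₀ * κ) * ‖c y‖ := by
            rw [hiii c y]
            have hLd : ((((F.P K).L : ℝ) ^ (F.P K).d) ^ (K - n)) ≠ 0 := pow_ne_zero _ (pow_ne_zero _ (by exact_mod_cast (F.P K).L_pos.ne'))
            field_simp
    have hB : q (ns (K - n) - ((κ : ℝ) : ℂ) • c) ≤ Real.sqrt 2 * (4500 * (F.L : ℝ) ^ 2 * ε₀ * κ) * q c :=
      hq_le_of_pointwise _ c _ (by positivity) hd2
    have hsplit : Kop (S c) - ((κ : ℝ) : ℂ) • c = (Kop (S c) - ns (K - n)) + (ns (K - n) - ((κ : ℝ) : ℂ) • c) := by abel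
    have hs2 : Real.sqrt 2 ≤ 3 / 2 := sqrt_two_le.1
    have hq0 : 0 ≤ q c := hq_nonneg c
    have hLε : 0 ≤ 4500 * (F.L : ℝ) ^ 2 * ε₀ * κ := by positivity
    calc q (Kop (S c) - ((κ : ℝ) : ℂ) • c) = q ((Kop (S c) - ns (K - n)) + (ns (K - n) - ((κ : ℝ) : ℂ) • c)) := by rw [← hsplit]
      _ ≤ q (Kop (S c) - ns (K - n)) + q (ns (K - n) - ((κ : ℝ) : ℂ) • c) := hq_add _ _
      _ ≤ Real.sqrt 2 * (3 / 10 ^ 6) * ‖toL2S F K c₀ (S c)‖ + Real.sqrt 2 * (4500 * (F.L : ℝ) ^ 2 * ε₀ * κ) * q c := add_le_add ha hB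
      _ ≤ (3 / 2) * (3 / 10 ^ 6) * ((3 / 2) * q c) + (3 / 2) * (4500 * (F.L : ℝ) ^ 2 * ε₀ * κ) * q c := by
          gcongr
          exact HS0 c
      _ = ((27 / 4 / 10 ^ 6 + (3 / 2) * (4500 * (F.L : ℝ) ^ 2 * ε₀) * κ) / κ) * κ * q c := by field_simp; ring
  -- the window numerics
  have hθ₀0 : 0 ≤ (27 / 4 / 10 ^ 6 + (3 / 2) * (4500 * (F.L : ℝ) ^ 2 * ε₀) * κ) / κ := by positivity
  have hθ₀' : (27 / 4 / 10 ^ 6 + (3 / 2) * (4500 * (F.L : ℝ) ^ 2 * ε₀) * κ) / κ * κ ≤ 1 / 10 ^ 5 := by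
    rw [div_mul_cancel₀ _ hκ0.ne']
    have hL2ε : (F.L : ℝ) ^ 2 * ε₀ ≤ 1 / 10 ^ 14 := by
      have hL3 : (F.L : ℝ) ^ 2 * ε₀ ≤ (F.L : ℝ) ^ 3 * ε₀ := by
        have : (F.L : ℝ) ^ 2 ≤ (F.L : ℝ) ^ 3 := pow_le_pow_right₀ hL1 (by norm_num)
        exact mul_le_mul_of_nonneg_right this hε₀.le
      nlinarith
    nlinarith
  have hCK0 : 0 ≤ Real.sqrt 2 * (1 + 3 / 10 ^ 6) := by positivity
  have hCK : Real.sqrt 2 * (1 + 3 / 10 ^ 6) ≤ 3 / 2 := by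
    have h14 : Real.sqrt 2 ≤ Real.sqrt ((283 / 200) ^ 2) := Real.sqrt_le_sqrt (by norm_num)
    rw [Real.sqrt_sq (by norm_num)] at h14
    calc Real.sqrt 2 * (1 + 3 / 10 ^ 6) ≤ (283 / 200) * (1 + 3 / 10 ^ 6) := mul_le_mul_of_nonneg_right h14 (by norm_num)
      _ ≤ 3 / 2 := by norm_num
  obtain ⟨hθ, hC₀0, hC₀δ⟩ := window_numerics hκlo' hθ₀' hCK
  have hs150 : Real.sqrt ((1 / 11250 : ℝ) / 2) = 1 / 150 := by
    rw [show (1 / 11250 : ℝ) / 2 = (1 / 150) ^ 2 by norm_num, Real.sqrt_sq (by norm_num)]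
  have hs75 : Real.sqrt (2 * (1 / 11250 : ℝ)) = 1 / 75 := by
    rw [show 2 * (1 / 11250 : ℝ) = (1 / 75) ^ 2 by norm_num, Real.sqrt_sq (by norm_num)]
  have hθ' : (27 / 4 / 10 ^ 6 + (3 / 2) * (4500 * (F.L : ℝ) ^ 2 * ε₀) * κ) / κ + Real.sqrt 2 * (1 + 3 / 10 ^ 6) * (Real.sqrt ((1 / 11250 : ℝ) / 2) * 26) / κ < 1 := by
    rw [hs150]; exact hθ
  have HQ4 := hQ4_of_rows F U₀ Kop S q hq_add hq_smul hq_def hκ0 (by norm_num : (0:ℝ) ≤ 3 / 2) (by norm_num : (0:ℝ) ≤ 26) hCK0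
    (by norm_num : (0:ℝ) < 1 / 11250) HS0 HS1 HK HAPP hθ'
  rw [hs150, hs75] at HQ4
  have hqm : ∀ m, q m = ‖toL2S F n c₁ (fun y' : Site (F.P n) 0 => m (siteShift (sites_eq F n K h) y'))‖ := fun m => rfl
  refine ⟨Kop, (3 / 2 + 26 + 26 / (1 / 75 : ℝ)) / (κ * (1 - ((27 / 4 / 10 ^ 6 + (3 / 2) * (4500 * (F.L : ℝ) ^ 2 * ε₀) * κ) / κ +
      Real.sqrt 2 * (1 + 3 / 10 ^ 6) * ((1 / 150 : ℝ) * 26) / κ))), Real.sqrt 2 * (3 / 10 ^ 6), hC₀0, by positivity, hC₀δ, HT, fun m => ?_, HKT⟩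
  obtain ⟨N, hN, r0, r1, r2⟩ := HQ4 m
  rw [hqm] at r0 r1 r2
  exact ⟨N, hN, r0, r1, r2⟩

end Summit.QuantumFields.YangMills.Theorems.Prop7LandauTransversalityRowsY1

end
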